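import Summits.BirchSwinnertonDyer.BirchSwinnertonDyer.Theorems.PrintX11aUpperNonSurjThreeSharpLocalNoTorsion
import Literature.NumberTheory.EllipticCurves.GaloisActionProofs
import Literature.NumberTheory.EllipticCurves.IwasawaCoinvariantsRankProofs
import Summits.BirchSwinnertonDyer.BirchSwinnertonDyer.Theorems.AdditiveBranchIMCGordTwoRankOneSmallImageDickson
import Summits.BirchSwinnertonDyer.Rank1Residual.X11b.AnticyclotomicLocalTowerTorsion
import HarnessLib

/-!
# Route `PrintX11a`, child crux U3 = `PrintX11a.UpperNonSurjThree` (item stmt-BirchSwinnertonDyer-20613),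
# line «finemu3» — ♯-road LOCAL FINITENESS I: the tower subgroup `H_v = Gal(K̄/K_∞) ⊓ D_v` versus `D_v`.
# (1) TAME TRANSFER: on a `Γ_K`-set with open stabilisers, a point fixed by `H_v` and moved with order prime to `p` by
# `σ ∈ D_v` is fixed by `σ` — so `E[p]^{H_v} = E(K_v)[p]` at EVERY place of a pair with `p ∤ #ρ̄_{E,p}(Γ_ℚ)`;
# (2) PRO-`p` DESCENT (tree, cell b2b): `E(K_v)[p] = 0 ⟹ E[p^∞]^{H_v} = 0`, any curve; hence the no-fixed-point test of
# `…SharpLocalNoTorsion` IS the level-0 test «`E(K_v)[p] = 0`», and there the `E[p]`-clause `res_{H_v} y = 0` descends to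
# «`y_v = 0` in `H¹(K_v, E[p])`»; ♯0 door with LEVEL-0 clauses
# (cell `bsd-print-x11a`, width seat `bsd-line-x11a-p1-w2` gen 2; REF V14 «explicit B_v» / V26 «local clauses … remain
# over K_{v,∞} and need a printed finite criterion»; `--supports` 20613; closes nothing)

HONEST FRAMING.  BSD is not proved by any of this; nothing is asserted about any curve; the crux and its stub
`stub_conjA_three` stay OPEN (class-wide statement (A) = an instance of Iwasawa's `μ`-conjecture).  THEOREMS ONLY
(no definition, no named fact, no `sorry`), all PROVED from tree theorems.

WHY.  The ♯0 certificate of the line («`R♭(E,p) = 0`», `…SharpLocal`, `…SharpDefs` §5 `SharpLocalCertAt`) is evaluated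
by a kit engine place by place.  Its local clauses are statements about `H_v ≤ Γ_K` (the decomposition group of the
cyclotomic tower at the chosen place above `v`): the no-fixed-point test `E[p]^{H_v} = 0` of `…SharpLocalNoTorsion` and
the clause «`res_{H_v} y = 0` in `H¹(H_v, E[p])`».  An engine only sees LEVEL-0 objects (`E[p]` as a `D_v`-module,
`y_v ∈ H¹(K_v, E[p])`); REF's notes V14/V26 ask for the finite criterion turning the former into the latter:

* §1 (TOPOLOGICAL CORE; any number field `K`, any `ℤ_p`-datum `κ`, any CLOSED `D ≤ Γ_K`): if `σ ∈ D`, `p ∤ n` and a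
  closed `S ⊆ Γ_K` contains `σ^m` for all `m ≡ 1 (mod n)`, then `S` meets `ker κ ⊓ D` (Cantor intersection of
  `S ∩ D ∩ κ⁻¹(p^k ℤ_p)` in the compact `Γ_K`; exponents by CRT); hence the **TAME TRANSFER**
  `smul_eq_self_of_forall_mem_kerSubgroup_inf`: open stabiliser at `P`, `P` fixed by `ker κ ⊓ D`, `σ ∈ D`, `σ^n • P = P`,
  `p ∤ n` ⟹ `σ • P = P`.  (Needed where `E(K_v)[p] ≠ 0`: there `E[p]^{H_v} = E[p]^{D_v}` is an EQUALITY of non-zero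
  groups, the input of the sequel on tower torsion at split multiplicative places.)
* §2 (`D = D_v`, closed — tree `X11b.AcSelmer.isClosed_decomp`): the transfer on `E[n]` and `E[p^∞]`;
  `E[p]^{H_v} = E[p]^{D_v}` under a tame exponent (`forall_kerSubgroup_inf_decomp_smul_eq_iff`); and, WITHOUT tameness,
  `noFixedPoints_kerSubgroup_inf_decomp_of_levelZero`: «`E(K_v)[p] = 0` ⟹ no non-zero `H_v`-fixed point of `E[p]`» = the
  binder `hloc`/`hT` of `…SharpLocalNoTorsion`, from the tree's pro-`p` descent
  `X11b.AcSelmer.fixedPoints_decomp_inf_kerSubgroup_eq_bot` (Castella-erratum hypothesis (iv) on the tower, cell b2b).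
* §3 `resSubgroup_decomp_eq_zero_of_resSubgroup_kerSubgroup_inf_decomp_eq_zero`: `E(K_v)[p] = 0 ∧ res_{H_v} y = 0 ⟹
  res_{D_v} y = 0` (a representative vanishing on `H_v ⊴ D_v` has `H_v`-fixed values on `D_v`).
* §4 over `ℚ`: `exists_tameExponent_of_irr_of_not_surj` (`E[p]` irreducible, `ρ̄` not onto ⟹ `n = #ρ̄(Γ_ℚ)` is prime to
  `p`, Serre Prop. 15 — the uniform tame exponent for (1)); the ♯0 door `conjAAt_of_irr_of_not_surj_of_forall_local_levelZero`
  displaying a set `T` of places with `E(ℚ_v)[p] = 0` and, at `v ∈ T`, the LEVEL-0 clause «`y_v = 0` in `H¹(ℚ_v, E[p])`»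
  (for `y ∈ Hom_G(G_{L,S}, E[p])`, `L = ℚ(E[p])`: the chosen prime of `L` above `v` splits in the `p`-extension cut out by
  `y`); §5 the doors on `ClassX11a W p ∧ ¬ Surj W p`.

ENGINE READING (U3: `p = 3`, images 3Ns/3Nn; U5: 5Ns/5S4; all of order prime to `p`): at every place with
`E(ℚ_v)[p] = 0` the ♯-clause is the vanishing of the level-0 local class; the places with `E(ℚ_v)[p] ≠ 0` (split `v = p`,
split `ℓ ≠ p`, non-split `ℓ ≡ −1 (p)`) keep the `E[p^∞]`-clause of `…SharpLocalKummer` (tower torsion: sequel file).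

References: [GreenbergLNM1716] §3 Lemmas 3.1–3.3 (local kernels over the cyclotomic tower are governed by
`E(F_{∞,η})[p^∞]`); [Serre1972] §2.4 Prop. 15; [SerreLocalFields1979] IX.§1 (p-groups acting on p-groups);
[DeoRaySujatha2023] §3 (c1)–(c3) and Lemma 5.1 (the level-0 conditions `E(K_v)[p] = 0`, `K(E[p]) ∩ K_∞ = K`);
[Castella2018Erratum] Thm. 1.1 (iv), Lemma 2.1; [NeukirchANT1999] Ch. II §9, Ch. IV §1; [Washington1997] §13.1;
REF STATUS 2026-08-28T06:26:48Z (V14), 07:20:16Z (V26).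
-/

set_option linter.dupNamespace false
set_option autoImplicit false

noncomputable section

open scoped Classical

open WeierstrassCurve Field NumberField IsDedekindDomain
  Literature.NumberTheory.EllipticCurves
  Literature.NumberTheory.EllipticCurves.GreenbergSelmer
  Literature.NumberTheory.EllipticCurves.Rank1Residual
  Literature.NumberTheory.GaloisRepresentations
  Summit.BirchSwinnertonDyer.Rank1Residual

namespace Summit.BirchSwinnertonDyer.BirchSwinnertonDyer.Theorems.UpperNonSurjThreeSharp

/-! ### §1 The topological core: Cantor intersection in the compact group `Γ_K` -/

section Core

variable {K : Type} [Field K] [NumberField K] {p : ℕ} [Fact p.Prime] (κ : ZpExtension K p)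

/-- **Cantor-intersection core.**  `D ≤ Γ_K` CLOSED, `σ ∈ D`, `p ∤ n`, `S ⊆ Γ_K` closed with `σ^m ∈ S` for every
`m ≡ 1 (mod n)` ⟹ `S` meets `ker κ ⊓ D = Gal(K̄/K_∞) ⊓ D`.  (CRT exponents `m_k ≡ 1 (n), ≡ 0 (p^k)`; `σ^{m_k}` lies in the
closed `C_k = S ∩ D ∩ κ⁻¹(p^k ℤ_p)`; the `C_k` decrease; compactness of `Γ_K`; `⋂_k p^k ℤ_p = 0`.)
[cite: NeukirchANT1999, Ch. IV §1 (1.1) (Γ_K profinite, compact)] [cite: Washington1997, §13.1 (layers `κ⁻¹(p^k ℤ_p)`)] -/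
theorem exists_mem_kerSubgroup_inf_of_forall_pow_mem {D : Subgroup (absoluteGaloisGroup K)}
    (hD : IsClosed (D : Set (absoluteGaloisGroup K))) {S : Set (absoluteGaloisGroup K)}
    (hS : IsClosed S) {σ : absoluteGaloisGroup K} (hσ : σ ∈ D) {n : ℕ} (hn : p.Coprime n)
    (hpow : ∀ m : ℕ, m ≡ 1 [MOD n] → σ ^ m ∈ S) :
    ∃ τ : absoluteGaloisGroup K, τ ∈ κ.kerSubgroup ⊓ D ∧ τ ∈ S := by
  -- the closed sets `C k = (S ∩ D) ∩ κ⁻¹(p^k ℤ_p)`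
  set C : ℕ → Set (absoluteGaloisGroup K) := fun k ↦
    (S ∩ (D : Set (absoluteGaloisGroup K))) ∩ (κ.layerSubgroup k : Set (absoluteGaloisGroup K))
  have hclosed : ∀ k, IsClosed (C k) := fun k ↦
    (hS.inter hD).inter ((κ.layerSubgroup k).isClosed_of_isOpen (κ.isOpen_layerSubgroup k))
  have hanti : ∀ k, C (k + 1) ⊆ C k := fun k ↦
    Set.inter_subset_inter_right _ (fun x hx ↦ κ.layerSubgroup_antitone (Nat.le_succ k) hx)
  have hne : ∀ k, (C k).Nonempty := by
    intro k
    obtain ⟨m, hm1, hmk⟩ := Nat.chineseRemainder (hn.symm.pow_right k) 1 0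
    obtain ⟨t, ht⟩ : p ^ k ∣ (m : ℕ) := (Nat.modEq_zero_iff_dvd).mp hmk
    refine ⟨σ ^ (m : ℕ), ⟨hpow m hm1, D.pow_mem hσ m⟩, ?_⟩
    rw [SetLike.mem_coe, ZpExtension.mem_layerSubgroup, map_pow, toAdd_pow, ht, mul_comm, mul_nsmul]
    refine ⟨t • (κ σ).toAdd, ?_⟩
    rw [nsmul_eq_mul, Nat.cast_pow]
  obtain ⟨τ, hτ⟩ := IsCompact.nonempty_iInter_of_sequence_nonempty_isCompact_isClosed C hanti hne
    (hclosed 0).isCompact hclosed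
  rw [Set.mem_iInter] at hτ
  -- `κ τ ∈ ⋂_k p^k ℤ_p = 0` (tree `X11b.AcSelmer.mem_kerSubgroup_of_forall_mem_layerSubgroup`)
  exact ⟨τ, ⟨X11b.AcSelmer.mem_kerSubgroup_of_forall_mem_layerSubgroup κ fun k ↦ (hτ k).2, (hτ 0).1.2⟩,
    (hτ 0).1.1⟩

omit [NumberField K] in
/-- An orbit map `g ↦ g • P` with OPEN stabiliser is locally constant (on `g₀ · Stab(P)` it is `g₀ • P`).
[cite: SerreGaloisCohomology1997, II.§1 (discrete `Γ`-modules: stabilisers open)] -/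
theorem isLocallyConstant_smul {X : Type*} [MulAction (absoluteGaloisGroup K) X] {P : X}
    (hP : IsOpen (MulAction.stabilizer (absoluteGaloisGroup K) P : Set (absoluteGaloisGroup K))) :
    IsLocallyConstant fun g : absoluteGaloisGroup K ↦ g • P := by
  refine (IsLocallyConstant.iff_eventually_eq _).mpr fun g₀ ↦ ?_
  have h1 : (fun g : absoluteGaloisGroup K ↦ g₀⁻¹ * g) ⁻¹'
      (MulAction.stabilizer (absoluteGaloisGroup K) P : Set (absoluteGaloisGroup K)) ∈ nhds g₀ :=
    (hP.preimage (continuous_const.mul continuous_id)).mem_nhds (by simp)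
  filter_upwards [h1] with g hg
  simp only [Set.mem_preimage, SetLike.mem_coe, MulAction.mem_stabilizer_iff, mul_smul] at hg
  calc g • P = g₀ • (g₀⁻¹ • g • P) := by rw [smul_inv_smul]
    _ = g₀ • P := by rw [hg]

/-- **TAME TRANSFER** (the theorem of this file).  `Γ_K` acting on `X` with open stabiliser at `P`; `D ≤ Γ_K` closed;
`P` fixed by `ker κ ⊓ D`; `σ ∈ D` with `σ^n • P = P`, `p ∤ n` ⟹ `σ • P = P` (core applied to `S = {g : g • P = σ • P}`
∋ `σ^{1+nt}`: some `τ ∈ ker κ ⊓ D` has `τ • P = σ • P`).  Inside `D`, the tower subgroup has the same fixed points as `D`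
on every orbit of exponent prime to `p` — «`K(P) ∩ K_∞ = K` locally».
[cite: DeoRaySujatha2023, §3 (c1) and Lemma 5.1 (`K(E[p]) ∩ K_cyc = K` when `p ∤ [K(E[p]):K]`)] [cite: NeukirchANT1999, Ch. IV §1 (1.1)] -/
theorem smul_eq_self_of_forall_mem_kerSubgroup_inf {D : Subgroup (absoluteGaloisGroup K)}
    (hD : IsClosed (D : Set (absoluteGaloisGroup K))) {X : Type*} [MulAction (absoluteGaloisGroup K) X]
    {P : X} (hP : IsOpen (MulAction.stabilizer (absoluteGaloisGroup K) P : Set (absoluteGaloisGroup K)))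
    (hfix : ∀ τ ∈ κ.kerSubgroup ⊓ D, τ • P = P) {σ : absoluteGaloisGroup K} (hσ : σ ∈ D) {n : ℕ}
    (hn : p.Coprime n) (hσn : σ ^ n • P = P) : σ • P = P := by
  have hfixpow : ∀ t : ℕ, (σ ^ n) ^ t • P = P := by
    intro t
    induction t with
    | zero => rw [pow_zero, one_smul]
    | succ t ih => rw [pow_succ, mul_smul, hσn, ih]
  have hpow : ∀ m : ℕ, m ≡ 1 [MOD n] → σ ^ m ∈ {g : absoluteGaloisGroup K | g • P = σ • P} := by
    intro m hm
    show σ ^ m • P = σ • P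
    rcases Nat.eq_zero_or_pos m with rfl | hm1
    · have h1 : n = 1 := Nat.dvd_one.mp ((Nat.modEq_zero_iff_dvd).mp hm.symm)
      subst h1
      rw [pow_one] at hσn
      rw [pow_zero, one_smul, hσn]
    · obtain ⟨t, ht⟩ := (Nat.modEq_iff_dvd' hm1).mp hm.symm
      have hm' : m = n * t + 1 := by omega
      rw [hm', pow_succ, ← (Commute.self_pow σ (n * t)).eq, mul_smul, pow_mul, hfixpow]
  obtain ⟨τ, hτ, hτS⟩ := exists_mem_kerSubgroup_inf_of_forall_pow_mem κ hD
    ((isLocallyConstant_smul hP).isClosed_fiber (σ • P)) hσ hn hpow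
  rw [Set.mem_setOf_eq] at hτS
  rw [← hτS]
  exact hfix τ hτ

end Core

/-! ### §2 Torsion points of `W` at a finite place: `Fix(Gal(K̄/K_∞) ⊓ D_v) = Fix(D_v)` on tame orbits -/

section Places

variable {K : Type} [Field K] [NumberField K] (W : WeierstrassCurve K) [W.IsElliptic] {p : ℕ}
  [Fact p.Prime] (κ : ZpExtension K p)

omit [NumberField K] [W.IsElliptic] [Fact p.Prime] in
/-- The stabiliser of a point of `E[n]` is open (it is the stabiliser of the underlying geometric point, tree
`isOpen_stabilizer_point_holds`). [cite: SilvermanAEC2009, VIII.§1 (points are defined over finite extensions)] -/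
theorem isOpen_stabilizer_geomTorsion (n : ℤ) (P : geomTorsion W n) :
    IsOpen (MulAction.stabilizer (absoluteGaloisGroup K) P : Set (absoluteGaloisGroup K)) := by
  have hP : (MulAction.stabilizer (absoluteGaloisGroup K) P : Set (absoluteGaloisGroup K)) =
      MulAction.stabilizer (absoluteGaloisGroup K) (P : geomPoints W) := by
    ext τ
    simp only [SetLike.mem_coe, MulAction.mem_stabilizer_iff, Subtype.ext_iff,
      Literature.NumberTheory.EllipticCurves.AddSubgroup.torsionBy.coe_smul]
  rw [hP]
  exact W.isOpen_stabilizer_point_holds (P : geomPoints W)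

omit [NumberField K] [W.IsElliptic] [Fact p.Prime] in
/-- The stabiliser of a point of `E[p^∞]` is open (same argument). [cite: SilvermanAEC2009, VIII.§1] -/
theorem isOpen_stabilizer_geomPrimaryTorsion_point (P : geomPrimaryTorsion W p) :
    IsOpen (MulAction.stabilizer (absoluteGaloisGroup K) P : Set (absoluteGaloisGroup K)) := by
  have hP : (MulAction.stabilizer (absoluteGaloisGroup K) P : Set (absoluteGaloisGroup K)) =
      MulAction.stabilizer (absoluteGaloisGroup K) (P : geomPoints W) := by
    ext τ
    simp only [SetLike.mem_coe, MulAction.mem_stabilizer_iff, Subtype.ext_iff,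
      primaryComponent.coe_smul]
  rw [hP]
  exact W.isOpen_stabilizer_point_holds (P : geomPoints W)

omit [W.IsElliptic] in
/-- **Tame transfer on `E[n]` at a finite place `v`.**  A point `P ∈ E[n]` fixed by `Gal(K̄/K_∞) ⊓ D_v` is fixed by
every `σ ∈ D_v` with `σ^m • P = P`, `p ∤ m`. [cite: GreenbergLNM1716, §3 Lemma 3.3 (local kernels via `E(F_{∞,η})`)]
[cite: DeoRaySujatha2023, §3 (c3)] -/
theorem geomTorsion_smul_eq_of_forall_kerSubgroup_inf_decomp {n : ℤ} (v : HeightOneSpectrum (𝓞 K))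
    (P : geomTorsion W n) (hfix : ∀ τ ∈ κ.kerSubgroup ⊓ decomp v, τ • P = P)
    {σ : absoluteGaloisGroup K} (hσ : σ ∈ decomp v) {m : ℕ} (hm : p.Coprime m) (hσm : σ ^ m • P = P) :
    σ • P = P :=
  smul_eq_self_of_forall_mem_kerSubgroup_inf κ (X11b.AcSelmer.isClosed_decomp v)
    (isOpen_stabilizer_geomTorsion W n P) hfix hσ hm hσm

omit [W.IsElliptic] in
/-- **Tame transfer on `E[p^∞]` at a finite place `v`** (same statement for `p`-primary torsion points; the exponent
hypothesis is per point and per `σ`). [cite: GreenbergLNM1716, §3 Lemma 3.3] -/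
theorem geomPrimaryTorsion_smul_eq_of_forall_kerSubgroup_inf_decomp (v : HeightOneSpectrum (𝓞 K))
    (P : geomPrimaryTorsion W p) (hfix : ∀ τ ∈ κ.kerSubgroup ⊓ decomp v, τ • P = P)
    {σ : absoluteGaloisGroup K} (hσ : σ ∈ decomp v) {m : ℕ} (hm : p.Coprime m) (hσm : σ ^ m • P = P) :
    σ • P = P :=
  smul_eq_self_of_forall_mem_kerSubgroup_inf κ (X11b.AcSelmer.isClosed_decomp v)
    (isOpen_stabilizer_geomPrimaryTorsion_point W P) hfix hσ hm hσm

omit [W.IsElliptic] in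
/-- **`E[p]^{Gal(K̄/K_∞) ⊓ D_v} = E[p]^{D_v}` under a tame exponent at `v`**: if every `σ ∈ D_v` has a power `σ^m`,
`p ∤ m`, acting trivially on `E[p]` (e.g. `p ∤ #ρ̄_{E,p}(Γ_K)`), then a point of `E[p]` is fixed by the tower subgroup iff
it is fixed by `D_v`, i.e. iff it is `K_v`-rational. [cite: DeoRaySujatha2023, §3 (c3) and Lemma 5.1]
[cite: GreenbergLNM1716, §3 Lemma 3.3] -/
theorem forall_kerSubgroup_inf_decomp_smul_eq_iff (v : HeightOneSpectrum (𝓞 K))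
    (htame : ∀ σ ∈ decomp v, ∃ m : ℕ, p.Coprime m ∧ ∀ Q : geomTorsion W (p : ℤ), σ ^ m • Q = Q)
    (P : geomTorsion W (p : ℤ)) :
    (∀ τ ∈ κ.kerSubgroup ⊓ decomp v, τ • P = P) ↔ ∀ σ ∈ decomp v, σ • P = P := by
  refine ⟨fun h σ hσ ↦ ?_, fun h τ hτ ↦ h τ hτ.2⟩
  obtain ⟨m, hm, hσm⟩ := htame σ hσ
  exact geomTorsion_smul_eq_of_forall_kerSubgroup_inf_decomp W κ v P h hσ hm (hσm P)

/-- **The no-fixed-point hypothesis of `…SharpLocalNoTorsion` from LEVEL 0 — no tameness needed.**  For ANY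
elliptic `W/K`, ANY `ℤ_p`-datum `κ` and ANY finite place `v`: if `E[p]` has no non-zero `D_v`-fixed point («`E(K_v)[p] = 0`»,
decided from the mod-`p` local representation), then it has no non-zero point fixed by `Gal(K̄/K_∞) ⊓ D_v` — verbatim the
binder `hloc`/`hT` of `torsionToPrimaryH1Sub_inf_decomp_injective_of_noFixedPoints` /
`conjAAt_of_irr_of_not_surj_of_forall_local_of_noFixedPoints`.  This is PRO-`p` DESCENT («a pro-`p` group acting on a
non-zero `p`-group has a non-zero fixed point», `D_v/(D_v ⊓ ker κ) ↪ ℤ_p`), landed by cell b2b as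
`X11b.AcSelmer.fixedPoints_decomp_inf_kerSubgroup_eq_bot` (Castella's erratum hypothesis (iv) on the tower); here only
the bookkeeping `E[p] ↔ E[p^∞][p]`. [cite: GreenbergLNM1716, §3 Lemma 3.1 (p. 86), Lemma 3.3]
[cite: SerreLocalFields1979, IX.§1 (p-groups acting on p-groups)] [cite: DeoRaySujatha2023, §3 (c3)] -/
theorem noFixedPoints_kerSubgroup_inf_decomp_of_levelZero (v : HeightOneSpectrum (𝓞 K))
    (h0 : ∀ P : geomTorsion W (p : ℤ), (∀ σ ∈ decomp v, σ • P = P) → P = 0) :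
    ∀ P : geomTorsion W (p : ℤ),
      (∀ σ : (κ.kerSubgroup ⊓ decomp v : Subgroup (absoluteGaloisGroup K)),
        (σ : absoluteGaloisGroup K) • P = P) → P = 0 := by
  -- `E[p^∞]^{D_v}` has no `p`-torsion (indeed is `0`): the b2b hypothesis `h0`
  have h0' : ∀ m : W.geomPrimaryTorsion p, (∀ d ∈ decomp v, d • m = m) → p • m = 0 → m = 0 :=
    fun m hm _ ↦ geomPrimaryTorsion_fixed_eq_zero_of_geomTorsion_fixed_eq_zero W p (decomp v)
      (fun P hP ↦ h0 P fun σ hσ ↦ hP ⟨σ, hσ⟩) m fun d ↦ hm d d.2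
  have hbot := X11b.AcSelmer.fixedPoints_decomp_inf_kerSubgroup_eq_bot κ W v h0'
  intro P hP
  -- view `P` in `E[p^∞]`
  set m : W.geomPrimaryTorsion p := AddSubgroup.inclusion (geomTorsion_le_geomPrimaryTorsion W p) P with hm
  have hmfix : m ∈ FixedPoints.addSubgroup ↥(decomp v ⊓ κ.kerSubgroup) (W.geomPrimaryTorsion p) := by
    rintro ⟨d, hd⟩
    have hd' : d ∈ κ.kerSubgroup ⊓ decomp v := Subgroup.mem_inf.mpr ⟨(Subgroup.mem_inf.mp hd).2,
      (Subgroup.mem_inf.mp hd).1⟩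
    have := hP ⟨d, hd'⟩
    apply Subtype.ext
    change d • (P : geomPoints W) = (P : geomPoints W)
    rw [← Literature.NumberTheory.EllipticCurves.AddSubgroup.torsionBy.coe_smul, this]
  rw [hbot, AddSubgroup.mem_bot] at hmfix
  exact AddSubgroup.inclusion_injective (geomTorsion_le_geomPrimaryTorsion W p) (by rw [← hm, hmfix, map_zero])

/-! ### §3 The `E[p]`-clause descends to level 0: `res_{Gal(K̄/K_∞) ⊓ D_v} y = 0 ⟹ res_{D_v} y = 0` when
`E(K_v)[p] = 0` and `D_v` acts tamely -/

/-- **The `E[p]`-clause descends to level 0 — no tameness needed.**  At a place `v` with `E(K_v)[p] = 0` (no non-zero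
`D_v`-fixed point of `E[p]`): for every `y ∈ H¹(Γ_K, E[p])`, if `res_{Gal(K̄/K_∞) ⊓ D_v} y = 0` then already `res_{D_v} y = 0`
— the local class `y_v ∈ H¹(K_v, E[p])` vanishes.  Proof: a representative cocycle `φ` vanishing on
`H_v = Gal(K̄/K_∞) ⊓ D_v` (tree `ResKernel.exists_cocycle_of_res_eq_zero`) has `φ(τσ) = τφ(σ)`, `φ(σ·σ⁻¹τσ) = φ(σ)` for
`τ ∈ H_v ⊴ D_v`, so `φ(σ) ∈ E[p]^{H_v} = 0` (§2, pro-`p` descent) for `σ ∈ D_v`.  (Inflation–restriction with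
`H¹(D_v/H_v, E[p]^{H_v}) = 0`.) [cite: SerreGaloisCohomology1997, I.§2.6 (b) (inflation–restriction)]
[cite: GreenbergLNM1716, §3 Lemma 3.1] -/
theorem resSubgroup_decomp_eq_zero_of_resSubgroup_kerSubgroup_inf_decomp_eq_zero
    (v : HeightOneSpectrum (𝓞 K))
    (h0 : ∀ P : geomTorsion W (p : ℤ), (∀ σ ∈ decomp v, σ • P = P) → P = 0)
    (y : discreteH1 (absoluteGaloisGroup K) (geomTorsion W (p : ℤ)))
    (hy : ResKernel.resSubgroup (κ.kerSubgroup ⊓ decomp v) (geomTorsion W (p : ℤ)) y = 0) :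
    ResKernel.resSubgroup (decomp v) (geomTorsion W (p : ℤ)) y = 0 := by
  haveI : ContinuousSMul (absoluteGaloisGroup K) (geomTorsion W (p : ℤ)) :=
    continuousSMul_geomTorsion W (isOpen_stabilizer_point_holds W) _
  have hcont : ∀ m : geomTorsion W (p : ℤ), Continuous fun g : absoluteGaloisGroup K ↦ g • m :=
    fun m ↦ continuous_id.smul continuous_const
  obtain ⟨φ, rfl, hφ⟩ := ResKernel.exists_cocycle_of_res_eq_zero (κ.kerSubgroup ⊓ decomp v) _ hcont y hy
  have hval : ∀ σ ∈ decomp v, φ.1 σ = 0 := by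
    intro σ hσ
    refine noFixedPoints_kerSubgroup_inf_decomp_of_levelZero W κ v h0 _ fun τ' ↦ ?_
    obtain ⟨τ, hτ⟩ := τ'
    -- `τ σ = σ (σ⁻¹ τ σ)` with `σ⁻¹ τ σ ∈ H_v`
    have hτ' : σ⁻¹ * τ * σ ∈ κ.kerSubgroup ⊓ decomp v := by
      refine ⟨?_, (decomp v).mul_mem ((decomp v).mul_mem ((decomp v).inv_mem hσ) hτ.2) hσ⟩
      have := Subgroup.Normal.conj_mem (inferInstanceAs κ.kerSubgroup.Normal) τ hτ.1 σ⁻¹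
      simpa using this
    have h1 := φ.2 τ σ
    have h2 := φ.2 σ (σ⁻¹ * τ * σ)
    rw [show σ * (σ⁻¹ * τ * σ) = τ * σ by group] at h2
    rw [h2, hφ _ hτ', map_zero, add_zero, hφ _ hτ, zero_add] at h1
    show τ • φ.1 σ = φ.1 σ
    exact h1.symm
  rw [ResKernel.resSubgroup_oneCocycleClass, oneCocycleClass_eq_zero_iff]
  exact ⟨0, fun σ ↦ by rw [ResKernel.pullback_subtype_apply, hval σ σ.2]; simp⟩

end Places

/-! ### §4 Over `ℚ`, `E[p]` irreducible and `ρ̄_{E,p}` not onto: tameness is automatic; the ♯0 door with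
LEVEL-0 clauses -/

section OverQ

variable (W : WeierstrassCurve ℚ) [W.IsElliptic] (p : ℕ) [Fact p.Prime]

/-- **Uniform tame exponent on the small-image locus.**  For `E/ℚ` with `E[p]` irreducible and `ρ̄_{E,p}` NOT surjective,
`n := #ρ̄_{E,p}(Γ_ℚ)` is prime to `p` (Serre's Prop. 15: a proper subgroup of `GL₂(𝔽_p)` of order divisible by `p` with
surjective determinant is Borel or everything; tree `not_dvd_card_of_not_hasSurjectiveModNGaloisRep`) and `σ^n` acts
trivially on `E[p]` for every `σ ∈ Γ_ℚ` (Lagrange in the finite image). [cite: Serre1972, §2.4 Prop. 15]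
[cite: DeoRaySujatha2023, §5 Lemma 5.1] -/
theorem exists_tameExponent_of_irr_of_not_surj (hirr : W.HasIrreducibleModPGaloisRep p)
    (hns : ¬ W.HasSurjectiveModNGaloisRep p) :
    ∃ m : ℕ, p.Coprime m ∧ ∀ (σ : absoluteGaloisGroup ℚ) (Q : geomTorsion W (p : ℤ)), σ ^ m • Q = Q := by
  have hp : p.Prime := Fact.out
  haveI : Finite (geomTorsion W (p : ℤ)) :=
    finite_torsionPoints_holds W (AlgebraicClosure ℚ) (by exact_mod_cast hp.ne_zero)
  obtain ⟨e, Φ, he, -⟩ := exists_frame_galoisRepTorsion_rat W p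
  refine ⟨Nat.card (galoisRepTorsion W p).range, ?_, fun σ Q ↦ ?_⟩
  · rw [← card_map_range_galoisRepTorsion W p Φ]
    exact (Nat.Prime.coprime_iff_not_dvd hp).mpr
      (not_dvd_card_of_not_hasSurjectiveModNGaloisRep W p Φ e he hirr hns)
  · have h1 : (⟨galoisRepTorsion W p σ, ⟨σ, rfl⟩⟩ : (galoisRepTorsion W p).range) ^
        (Nat.card (galoisRepTorsion W p).range) = 1 := pow_card_eq_one'
    rw [← galoisRepTorsion_apply, map_pow, show galoisRepTorsion W p σ ^ _ = 1 from congrArg Subtype.val h1]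
    rfl

/-- **♯0 WITH LEVEL-0 CLAUSES.**  `E/ℚ` with `E[p]` irreducible and `ρ̄_{E,p}` not onto; `T` a set of finite places at
each of which `E[p]` has no non-zero `D_v`-fixed point («`E(ℚ_v)[p] = 0`», displayed hypothesis `hT`, level 0).  If for
every cyclotomic `κ` every `y ∈ H¹(G_ℚ, E[p]; S)` (`S = {bad} ∪ {p}`) which satisfies the ♯-clause (b) of `…SharpLocal` at
every finite place AND whose LOCAL CLASS VANISHES at every `v ∈ T` (`res_{D_v} y = 0` in `H¹(D_v, E[p])`) is `0`, then
statement (A) `Rank1Residual.ConjAAt W p` holds at the pair.  The extra clauses are consequences of (b) (§2–§3), so the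
engine may use them; at `v ∈ T` nothing about the tower is left to evaluate.  PROVED, no named fact; nothing asserted
about any curve. [cite: CoatesSujatha2005, §3 statement (A)] [cite: GreenbergLNM1716, §3 Lemmas 3.1–3.3]
[cite: DeoRaySujatha2023, §3 (c1)–(c3)] -/
theorem conjAAt_of_irr_of_not_surj_of_forall_local_levelZero (hirr : W.HasIrreducibleModPGaloisRep p)
    (hns : ¬ W.HasSurjectiveModNGaloisRep p) (T : Set (HeightOneSpectrum (𝓞 ℚ)))
    (hT : ∀ v ∈ T, ∀ P : geomTorsion W (p : ℤ), (∀ σ ∈ decomp v, σ • P = P) → P = 0)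
    (hcert : ∀ κ : ZpExtension ℚ p, κ.IsCyclotomic →
      ∀ y : discreteH1 (absoluteGaloisGroup ℚ) (geomTorsion W (p : ℤ)),
        y ∈ h1Unramified (geomTorsion W (p : ℤ)) (W.badPlaces (𝓞 ℚ) ∪ {v | ((p : ℤ) : 𝓞 ℚ) ∈ v.asIdeal}) →
        (∀ v : HeightOneSpectrum (𝓞 ℚ),
          W.torsionToPrimaryH1Sub p (κ.kerSubgroup ⊓ decomp v)
            (ResKernel.resSubgroup (κ.kerSubgroup ⊓ decomp v) (geomTorsion W (p : ℤ)) y) = 0) →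
        (∀ v ∈ T, ResKernel.resSubgroup (decomp v) (geomTorsion W (p : ℤ)) y = 0) →
        y = 0) :
    ConjAAt W p :=
  conjAAt_of_irr_of_not_surj_of_forall_local_of_noFixedPoints W p hirr hns T
    (fun κ _ v hv ↦ noFixedPoints_kerSubgroup_inf_decomp_of_levelZero W κ v (hT v hv))
    fun κ hκ y hunr hloc hT0 ↦ hcert κ hκ y hunr hloc fun v hv ↦
      resSubgroup_decomp_eq_zero_of_resSubgroup_kerSubgroup_inf_decomp_eq_zero W κ v (hT v hv) y (hT0 v hv)

/-! ### §5 The door on the route's domain `ClassX11a W p ∧ ¬ Surj W p` (U3 at `p = 3`, U5 at `p = 5`) -/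

/-- **U-domain door, ♯0 with level-0 clauses**: at a non-surjective X11a pair, a set `T` of places with `E(ℚ_v)[p] = 0`
(level 0) and the local certificate «every `y ∈ H¹(G_ℚ, E[p]; S)` satisfying (b) everywhere and `y_v = 0` at `v ∈ T` is
`0`» (for every cyclotomic `κ`) give statement (A) at the pair.  PROVED; (A) asserted for no curve; `stub_conjA_three`
stays OPEN. [cite: CoatesSujatha2005, §3 statement (A)] [cite: DeoRaySujatha2023, §3 (c1)–(c3)] -/
theorem _root_.Summit.BirchSwinnertonDyer.Rank1Residual.ClassX11a.conjAAt_of_not_surj_of_forall_local_levelZero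
    (W : WeierstrassCurve ℚ) [W.IsElliptic] [W.IsGloballyMinimal] (p : ℕ) [Fact p.Prime]
    (hX : ClassX11a W p) (hns : ¬ Surj W p) (T : Set (HeightOneSpectrum (𝓞 ℚ)))
    (hT : ∀ v ∈ T, ∀ P : geomTorsion W (p : ℤ), (∀ σ ∈ decomp v, σ • P = P) → P = 0)
    (hcert : ∀ κ : ZpExtension ℚ p, κ.IsCyclotomic →
      ∀ y : discreteH1 (absoluteGaloisGroup ℚ) (geomTorsion W (p : ℤ)),
        y ∈ h1Unramified (geomTorsion W (p : ℤ)) (W.badPlaces (𝓞 ℚ) ∪ {v | ((p : ℤ) : 𝓞 ℚ) ∈ v.asIdeal}) →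
        (∀ v : HeightOneSpectrum (𝓞 ℚ),
          W.torsionToPrimaryH1Sub p (κ.kerSubgroup ⊓ decomp v)
            (ResKernel.resSubgroup (κ.kerSubgroup ⊓ decomp v) (geomTorsion W (p : ℤ)) y) = 0) →
        (∀ v ∈ T, ResKernel.resSubgroup (decomp v) (geomTorsion W (p : ℤ)) y = 0) →
        y = 0) :
    ConjAAt W p :=
  conjAAt_of_irr_of_not_surj_of_forall_local_levelZero W p hX.irr hns T hT hcert

/-- **U-domain door, level-0 tower-torsion test alone** (for records that keep the `E[p^∞]`-clause elsewhere): at an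
X11a pair, `E(ℚ_v)[p] = 0` at the places of `T` ⟹ the hypothesis `hT` of
`ClassX11a.conjAAt_of_not_surj_of_forall_local_of_noFixedPoints` (every `κ`, cyclotomic or not). PROVED.
[cite: DeoRaySujatha2023, §3 (c3)] [cite: GreenbergLNM1716, §3 Lemma 3.3] -/
theorem _root_.Summit.BirchSwinnertonDyer.Rank1Residual.ClassX11a.noFixedPoints_kerSubgroup_inf_decomp_of_levelZero
    (W : WeierstrassCurve ℚ) [W.IsElliptic] (p : ℕ) [Fact p.Prime] (T : Set (HeightOneSpectrum (𝓞 ℚ)))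
    (hT : ∀ v ∈ T, ∀ P : geomTorsion W (p : ℤ), (∀ σ ∈ decomp v, σ • P = P) → P = 0) :
    ∀ κ : ZpExtension ℚ p, κ.IsCyclotomic → ∀ v ∈ T, ∀ P : geomTorsion W (p : ℤ),
      (∀ σ : (κ.kerSubgroup ⊓ decomp v : Subgroup (absoluteGaloisGroup ℚ)),
        (σ : absoluteGaloisGroup ℚ) • P = P) → P = 0 :=
  fun κ _ v hv ↦ UpperNonSurjThreeSharp.noFixedPoints_kerSubgroup_inf_decomp_of_levelZero W κ v (hT v hv)

end OverQ

end Summit.BirchSwinnertonDyer.BirchSwinnertonDyer.Theorems.UpperNonSurjThreeSharp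

end
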